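import Mathlib
import HarnessLib.Audit
import Summits.PneNP.PneNP.Theorems.PstarChordReadSlackTwo

/-!
# Boundary count for a family of defect monomials (ROUND-24, O1 at general slack; memo g22 §24)

FRONTIER range-avoidance ladder, rung F-N3, ROUND 24 (cell `pnp-ideate`, prover-2 memo `g22/O1-PAIRCORE-g22.md` §24; typed target
`PstarCoreBoundTargets.TerminalPeelable` (p646951); restricted-model proof complexity — nothing here bears on `P` versus `NP`).

The slack-one and slack-two files count the boundary of `J₀` plus two, three or four inserted monomials by hand.  Here the count is done once for an
arbitrary indexed family: monomials `mon k ∉ J₀` (`k ∈ K`) with AND pair `{priv k, sec k}`, where `priv k` is a boundary variable of `J₀` read inside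
`J₀` (a private of a chord), the `priv k` are pairwise distinct, and the second variable `sec k` is NOT a boundary variable of `J₀` and is read by some
other member of `J₀ ∪ mon(K)` (an inside partner, or a hub partner shared with another gate of the family).  Then

* `card_bdry_union_le` — `#bdry(J₀ ∪ mon K) + #K ≤ #bdry J₀ + 2·#K` and `#(J₀ ∪ mon K) = #J₀ + #K`
  (`bdry(J₀ ∪ mon K) ⊆ (bdry J₀ ∖ priv K) ∪ XOR-variables of the family`);
* `card_le_slack` — with `(r, 3/2)`-expansion on `J₀ ∪ mon K` and `2·#bdry J₀ ≤ 3·#J₀ + t`: **`#K ≤ t`** — a family of defects of total size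
  more than the slack is not affordable.  This is the engine of `PstarChordReadSlackGeneral` (`t + 2` slice-generic chords kill slack `t`).

No Assumption A.
-/

set_option linter.dupNamespace false -- `Summit.PneNP.PneNP.…`: summit = sub-problem name (D-0017 single-conjunct layout)

open Finset Literature.Computability.Complexity
open Summit.PneNP.PneNP.Theorems.PstarSALevel (varSet bdry BoundaryExpanding)
open Summit.PneNP.PneNP.Theorems.PstarMaxSharingReaders (exists_mem_of_mem_bdry)
open Summit.PneNP.PneNP.Theorems.PstarGateUnit (mem_bdry_of_unique)
open Summit.PneNP.PneNP.Theorems.PstarNorCoreTools (eq_of_mem_bdry)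
open Summit.PneNP.PneNP.Theorems.PstarChordReadSlackOne (mem_varSet_of_pair)

namespace Summit.PneNP.PneNP.Theorems.PstarChordReadSlackCount

variable {n m : ℕ} {κ : Type*}

/-- **Boundary of `J₀` plus a family of defect monomials.**  See the module docstring for the hypotheses. -/
theorem card_bdry_union_le (I : LocalMap 4 n m) {J₀ : Finset (Fin m)} (K : Finset κ) (mon : κ → Fin m) (priv sec : κ → Fin n)
    (hmonJ : ∀ k ∈ K, mon k ∉ J₀)
    (hpair : ∀ k ∈ K, (I.vars (mon k) 2 = priv k ∧ I.vars (mon k) 3 = sec k) ∨ (I.vars (mon k) 2 = sec k ∧ I.vars (mon k) 3 = priv k))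
    (hprivJ : ∀ k ∈ K, ∃ j ∈ J₀, priv k ∈ varSet I j) (hprivb : ∀ k ∈ K, priv k ∈ bdry I J₀) (hsecb : ∀ k ∈ K, sec k ∉ bdry I J₀)
    (hsec : ∀ k ∈ K, (∃ j ∈ J₀, sec k ∈ varSet I j) ∨ (∃ k' ∈ K, k' ≠ k ∧ sec k ∈ varSet I (mon k')))
    (hinj : ∀ k ∈ K, ∀ k' ∈ K, priv k = priv k' → k = k') :
    (bdry I (J₀ ∪ K.image mon)).card + K.card ≤ (bdry I J₀).card + 2 * K.card ∧ (J₀ ∪ K.image mon).card = J₀.card + K.card := by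
  classical
  -- the monomials are pairwise distinct
  have hmoninj : ∀ k ∈ K, ∀ k' ∈ K, mon k = mon k' → k = k' := by
    intro k hk k' hk' e
    have P := hpair k hk
    rw [e] at P
    rcases P with ⟨h2, h3⟩ | ⟨h2, h3⟩ <;> rcases hpair k' hk' with ⟨h2', h3'⟩ | ⟨h2', h3'⟩
    · exact hinj k hk k' hk' (h2.symm.trans h2')
    · exact absurd (hprivb k hk) (h2.symm.trans h2' ▸ hsecb k' hk')
    · exact absurd (hprivb k hk) (h3.symm.trans h3' ▸ hsecb k' hk')
    · exact hinj k hk k' hk' (h3.symm.trans h3')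
  have himg : (K.image mon).card = K.card := card_image_of_injOn fun k hk k' hk' e => hmoninj k hk k' hk' e
  have hdisj : Disjoint J₀ (K.image mon) := by
    rw [disjoint_right]
    intro g hg hgJ
    obtain ⟨k, hk, rfl⟩ := mem_image.1 hg
    exact hmonJ k hk hgJ
  refine ⟨?_, by rw [card_union_of_disjoint hdisj, himg]⟩
  -- the slots of a monomial of the family
  have slots : ∀ k ∈ K, ∀ u ∈ varSet I (mon k), u = I.vars (mon k) 0 ∨ u = I.vars (mon k) 1 ∨ u = priv k ∨ u = sec k := by
    intro k hk u hu
    unfold PstarSALevel.varSet at hu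
    obtain ⟨s, -, hs⟩ := mem_image.1 hu
    have h4 : ∀ t : Fin 4, t = 0 ∨ t = 1 ∨ t = 2 ∨ t = 3 := by decide
    rcases h4 s with rfl | rfl | rfl | rfl
    · exact Or.inl hs.symm
    · exact Or.inr (Or.inl hs.symm)
    · rcases hpair k hk with ⟨h2, -⟩ | ⟨h2, -⟩
      · exact Or.inr (Or.inr (Or.inl (hs.symm.trans h2)))
      · exact Or.inr (Or.inr (Or.inr (hs.symm.trans h2)))
    · rcases hpair k hk with ⟨-, h3⟩ | ⟨-, h3⟩
      · exact Or.inr (Or.inr (Or.inr (hs.symm.trans h3)))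
      · exact Or.inr (Or.inr (Or.inl (hs.symm.trans h3)))
  -- the inclusion
  set X := J₀ ∪ K.image mon with hX
  set P := K.image priv with hP
  set N := K.biUnion fun k => ({I.vars (mon k) 0, I.vars (mon k) 1} : Finset (Fin n)) with hN
  have hsub : bdry I X ⊆ (bdry I J₀ \ P) ∪ N := by
    intro u hu
    obtain ⟨j, hjX, huj⟩ := exists_mem_of_mem_bdry I hu
    have uniq : ∀ j' ∈ X, u ∈ varSet I j' → j' = j := fun j' hj' h => eq_of_mem_bdry I hj' hjX hu h huj
    rw [mem_union, mem_sdiff]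
    rcases mem_union.1 hjX with hjJ | hjK
    · refine Or.inl ⟨mem_bdry_of_unique I hjJ huj fun j' hj' h => uniq j' (mem_union_left _ hj') h, fun huP => ?_⟩
      obtain ⟨k, hk, hku⟩ := mem_image.1 huP
      have hread : u ∈ varSet I (mon k) := hku ▸ (mem_varSet_of_pair (hpair k hk)).1
      have e := uniq (mon k) (mem_union_right _ (mem_image_of_mem mon hk)) hread
      exact hmonJ k hk (e ▸ hjJ)
    · right
      obtain ⟨k, hk, hkj⟩ := mem_image.1 hjK
      subst hkj
      rcases slots k hk u huj with h0 | h1 | hp | hs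
      · exact mem_biUnion.2 ⟨k, hk, by rw [h0]; exact mem_insert_self _ _⟩
      · exact mem_biUnion.2 ⟨k, hk, by rw [h1]; exact mem_insert_of_mem (mem_singleton_self _)⟩
      · exfalso
        obtain ⟨j₀, hj₀, hj₀u⟩ := hprivJ k hk
        have e := uniq j₀ (mem_union_left _ hj₀) (hp ▸ hj₀u)
        exact hmonJ k hk (e ▸ hj₀)
      · exfalso
        rcases hsec k hk with ⟨j₀, hj₀, hj₀u⟩ | ⟨k', hk', hne, hk'u⟩
        · have e := uniq j₀ (mem_union_left _ hj₀) (hs ▸ hj₀u)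
          exact hmonJ k hk (e ▸ hj₀)
        · have e := uniq (mon k') (mem_union_right _ (mem_image_of_mem mon hk')) (hs ▸ hk'u)
          exact hne (hmoninj k' hk' k hk e)
  -- the count
  have hPcard : P.card = K.card := card_image_of_injOn fun k hk k' hk' e => hinj k hk k' hk' e
  have hPsub : P ⊆ bdry I J₀ := fun u hu => by
    obtain ⟨k, hk, rfl⟩ := mem_image.1 hu
    exact hprivb k hk
  have hNcard : N.card ≤ 2 * K.card := by
    refine (card_biUnion_le).trans ?_
    rw [mul_comm]
    exact (sum_le_card_nsmul _ _ 2 fun k _ => card_le_two).trans (by simp)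
  have h1 := card_le_card hsub
  have h2 := card_union_le (bdry I J₀ \ P) N
  have h3 : (bdry I J₀ \ P).card = (bdry I J₀).card - P.card := card_sdiff_of_subset hPsub
  have h4 := card_le_card hPsub
  omega

/-- **A family of defects larger than the slack is not affordable**: with `(r, 3/2)`-expansion on `J₀ ∪ mon K` and `2·#bdry J₀ ≤ 3·#J₀ + t`,
`#K ≤ t`. -/
theorem card_le_slack (I : LocalMap 4 n m) {r t : ℕ} (hB : BoundaryExpanding r I) {J₀ : Finset (Fin m)} (K : Finset κ) (mon : κ → Fin m)
    (priv sec : κ → Fin n) (hmonJ : ∀ k ∈ K, mon k ∉ J₀)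
    (hpair : ∀ k ∈ K, (I.vars (mon k) 2 = priv k ∧ I.vars (mon k) 3 = sec k) ∨ (I.vars (mon k) 2 = sec k ∧ I.vars (mon k) 3 = priv k))
    (hprivJ : ∀ k ∈ K, ∃ j ∈ J₀, priv k ∈ varSet I j) (hprivb : ∀ k ∈ K, priv k ∈ bdry I J₀) (hsecb : ∀ k ∈ K, sec k ∉ bdry I J₀)
    (hsec : ∀ k ∈ K, (∃ j ∈ J₀, sec k ∈ varSet I j) ∨ (∃ k' ∈ K, k' ≠ k ∧ sec k ∈ varSet I (mon k')))
    (hinj : ∀ k ∈ K, ∀ k' ∈ K, priv k = priv k' → k = k') (hr : (J₀ ∪ K.image mon).card ≤ r)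
    (hslack : 2 * (bdry I J₀).card ≤ 3 * J₀.card + t) : K.card ≤ t := by
  obtain ⟨h₁, h₂⟩ := card_bdry_union_le I K mon priv sec hmonJ hpair hprivJ hprivb hsecb hsec hinj
  have hexp := hB _ hr
  rw [h₂] at hexp
  omega

/-! ## General form: repeated monomials, unrestricted second variables -/

/-- **Boundary of `J₀` plus a family of defects, general form.**  Keys `k ∈ K` with pairwise distinct boundary privates `priv k` read inside `J₀`,
monomials `mon k ∉ J₀` (possibly equal for different keys) with AND pair `{priv k, sec k}`, and `sec k` read by a member of `J₀ ∪ mon K` other than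
`mon k` (no condition `sec k ∉ bdry J₀`).  Then `#bdry(J₀ ∪ mon K) + #K ≤ #bdry J₀ + 2·#(mon K)` and `#(J₀ ∪ mon K) = #J₀ + #(mon K)`. -/
theorem card_bdry_union_le' (I : LocalMap 4 n m) {J₀ : Finset (Fin m)} (K : Finset κ) (mon : κ → Fin m) (priv sec : κ → Fin n)
    (hmonJ : ∀ k ∈ K, mon k ∉ J₀)
    (hpair : ∀ k ∈ K, (I.vars (mon k) 2 = priv k ∧ I.vars (mon k) 3 = sec k) ∨ (I.vars (mon k) 2 = sec k ∧ I.vars (mon k) 3 = priv k))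
    (hprivJ : ∀ k ∈ K, ∃ j ∈ J₀, priv k ∈ varSet I j) (hprivb : ∀ k ∈ K, priv k ∈ bdry I J₀)
    (hsec : ∀ k ∈ K, (∃ j ∈ J₀, sec k ∈ varSet I j) ∨ (∃ k' ∈ K, mon k' ≠ mon k ∧ sec k ∈ varSet I (mon k')))
    (hinj : ∀ k ∈ K, ∀ k' ∈ K, priv k = priv k' → k = k') :
    (bdry I (J₀ ∪ K.image mon)).card + K.card ≤ (bdry I J₀).card + 2 * (K.image mon).card ∧
      (J₀ ∪ K.image mon).card = J₀.card + (K.image mon).card := by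
  classical
  have hdisj : Disjoint J₀ (K.image mon) := by
    rw [disjoint_right]
    intro g hg hgJ
    obtain ⟨k, hk, rfl⟩ := mem_image.1 hg
    exact hmonJ k hk hgJ
  refine ⟨?_, card_union_of_disjoint hdisj⟩
  have slots : ∀ k ∈ K, ∀ u ∈ varSet I (mon k), u = I.vars (mon k) 0 ∨ u = I.vars (mon k) 1 ∨ u = priv k ∨ u = sec k := by
    intro k hk u hu
    unfold PstarSALevel.varSet at hu
    obtain ⟨s, -, hs⟩ := mem_image.1 hu
    have h4 : ∀ t : Fin 4, t = 0 ∨ t = 1 ∨ t = 2 ∨ t = 3 := by decide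
    rcases h4 s with rfl | rfl | rfl | rfl
    · exact Or.inl hs.symm
    · exact Or.inr (Or.inl hs.symm)
    · rcases hpair k hk with ⟨h2, -⟩ | ⟨h2, -⟩
      · exact Or.inr (Or.inr (Or.inl (hs.symm.trans h2)))
      · exact Or.inr (Or.inr (Or.inr (hs.symm.trans h2)))
    · rcases hpair k hk with ⟨-, h3⟩ | ⟨-, h3⟩
      · exact Or.inr (Or.inr (Or.inr (hs.symm.trans h3)))
      · exact Or.inr (Or.inr (Or.inl (hs.symm.trans h3)))
  set X := J₀ ∪ K.image mon with hX
  set P := K.image priv with hP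
  set N := (K.image mon).biUnion fun g => ({I.vars g 0, I.vars g 1} : Finset (Fin n)) with hN
  have hsub : bdry I X ⊆ (bdry I J₀ \ P) ∪ N := by
    intro u hu
    obtain ⟨j, hjX, huj⟩ := exists_mem_of_mem_bdry I hu
    have uniq : ∀ j' ∈ X, u ∈ varSet I j' → j' = j := fun j' hj' h => eq_of_mem_bdry I hj' hjX hu h huj
    rw [mem_union, mem_sdiff]
    rcases mem_union.1 hjX with hjJ | hjK
    · refine Or.inl ⟨mem_bdry_of_unique I hjJ huj fun j' hj' h => uniq j' (mem_union_left _ hj') h, fun huP => ?_⟩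
      obtain ⟨k, hk, hku⟩ := mem_image.1 huP
      have hread : u ∈ varSet I (mon k) := hku ▸ (mem_varSet_of_pair (hpair k hk)).1
      have e := uniq (mon k) (mem_union_right _ (mem_image_of_mem mon hk)) hread
      exact hmonJ k hk (e ▸ hjJ)
    · right
      obtain ⟨k, hk, hkj⟩ := mem_image.1 hjK
      subst hkj
      rcases slots k hk u huj with h0 | h1 | hp | hs
      · exact mem_biUnion.2 ⟨mon k, mem_image_of_mem mon hk, by rw [h0]; exact mem_insert_self _ _⟩
      · exact mem_biUnion.2 ⟨mon k, mem_image_of_mem mon hk, by rw [h1]; exact mem_insert_of_mem (mem_singleton_self _)⟩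
      · exfalso
        obtain ⟨j₀, hj₀, hj₀u⟩ := hprivJ k hk
        have e := uniq j₀ (mem_union_left _ hj₀) (hp ▸ hj₀u)
        exact hmonJ k hk (e ▸ hj₀)
      · exfalso
        rcases hsec k hk with ⟨j₀, hj₀, hj₀u⟩ | ⟨k', hk', hne, hk'u⟩
        · have e := uniq j₀ (mem_union_left _ hj₀) (hs ▸ hj₀u)
          exact hmonJ k hk (e ▸ hj₀)
        · exact hne (uniq (mon k') (mem_union_right _ (mem_image_of_mem mon hk')) (hs ▸ hk'u))
  have hPcard : P.card = K.card := card_image_of_injOn fun k hk k' hk' e => hinj k hk k' hk' e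
  have hPsub : P ⊆ bdry I J₀ := fun u hu => by
    obtain ⟨k, hk, rfl⟩ := mem_image.1 hu
    exact hprivb k hk
  have hNcard : N.card ≤ 2 * (K.image mon).card := by
    refine (card_biUnion_le).trans ?_
    rw [mul_comm]
    exact (sum_le_card_nsmul _ _ 2 fun g _ => card_le_two).trans (by simp)
  have h1 := card_le_card hsub
  have h2 := card_union_le (bdry I J₀ \ P) N
  have h3 : (bdry I J₀ \ P).card = (bdry I J₀).card - P.card := card_sdiff_of_subset hPsub
  have h4 := card_le_card hPsub
  omega

/-- **A family of defects with more distinct privates than the slack is not affordable** (general form of `card_le_slack`). -/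
theorem card_le_slack' (I : LocalMap 4 n m) {r t : ℕ} (hB : BoundaryExpanding r I) {J₀ : Finset (Fin m)} (K : Finset κ) (mon : κ → Fin m)
    (priv sec : κ → Fin n) (hmonJ : ∀ k ∈ K, mon k ∉ J₀)
    (hpair : ∀ k ∈ K, (I.vars (mon k) 2 = priv k ∧ I.vars (mon k) 3 = sec k) ∨ (I.vars (mon k) 2 = sec k ∧ I.vars (mon k) 3 = priv k))
    (hprivJ : ∀ k ∈ K, ∃ j ∈ J₀, priv k ∈ varSet I j) (hprivb : ∀ k ∈ K, priv k ∈ bdry I J₀)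
    (hsec : ∀ k ∈ K, (∃ j ∈ J₀, sec k ∈ varSet I j) ∨ (∃ k' ∈ K, mon k' ≠ mon k ∧ sec k ∈ varSet I (mon k')))
    (hinj : ∀ k ∈ K, ∀ k' ∈ K, priv k = priv k' → k = k') (hr : (J₀ ∪ K.image mon).card ≤ r)
    (hslack : 2 * (bdry I J₀).card ≤ 3 * J₀.card + t) : K.card ≤ t := by
  obtain ⟨h₁, h₂⟩ := card_bdry_union_le' I K mon priv sec hmonJ hpair hprivJ hprivb hsec hinj
  have hexp := hB _ hr
  rw [h₂] at hexp
  have h₃ : (K.image mon).card ≤ K.card := card_image_le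
  omega

end Summit.PneNP.PneNP.Theorems.PstarChordReadSlackCount
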